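import Summits.CriticalPhenomena.PercolationContinuityZ3.Theorems.PercNearOneGluingNoHeavyLowerTailIncStarApexUnicyclicSchema
import Summits.CriticalPhenomena.PercolationContinuityZ3.Theorems.PercNearOneGluingNoHeavyLowerTailIncStarTwoPortConcavity
import HarnessLib

/-!
# THE INCREASING STAR ON EVERY WEIGHT WHOSE ENVIRONMENT HAS AT MOST ONE CYCLE

Support file for the Sahi programme (`--supports stmt-CriticalPhenomena-4575`, prover prim-sahi-p2 gen 21).  No definitions, no named
facts, no sorries; standard axioms.  Memo `run/shared/lean/prim/prim-sahi/prim-sahi-p2/gen21/THEOREM-H.md` §3, `PROOF-E3.md` §31.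

**Theorem `incStar_nonneg_of_apexUnicyclic`.**  For product Bernoulli percolation `prodBernoulli w` on the pairs of `Fin n` with root `s`
and targets `a, b, c`: if the environment `H(w) = fromEdgeSet {z | s ∉ z ∧ w z ≠ 0}` becomes acyclic after deleting one pair `z₀`
(`H(w)` is a forest plus at most one pair — 'apex + at most one cycle'), then Sahi's cubic of the increasing star is non-negative:
`0 ≤ E₃({s↔a},{s↔b},{s↔c})`.
Proof: the unicyclic schema of p2 gen 20 (`IncStar.incStar_nonneg_of_apexUnicyclic_of_cycleChord`: THEOREM C's induction with THEOREM B
for bridges and the blob move, GIVEN the chord inequality along cycle pairs) with its hypothesis — CONJECTURE B-cyc — discharged by the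
pair-concavity theorem `IncStar.incStar_pair_chord_of_acyclic` (`…IncStarTwoPortConcavity`, from the two-port branch lemma), via the graph
lemma `isAcyclic_deleteEdges_of_cyclePair`: if `G − z₀` is acyclic and the edge `s(u,v)` of `G` has `u, v` joined in `G − s(u,v)`, then
`G − s(u,v)` is acyclic (a walk split at `z₀`).
* `incStar_bernstein_nonneg_of_acyclic` — COROLLARY: all four one-pair Bernstein coefficients of `E₃` along a pair whose deletion leaves an
  acyclic environment are `≥ 0` (the hypothesis of the edge-induction schemas, on this class).
-/

namespace Summit.CriticalPhenomena.PercolationContinuityZ3.Theorems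

namespace IncStar

open MeasureTheory Set Literature.Probability.Percolation Literature.Probability.LatticeModels EdgeInduction
open scoped Classical

/-- Splitting a walk with no repeated edge at one of its edges `s(x,y)`: the two outer pieces avoid that edge. [folklore] -/
theorem walk_split_at_edge {V : Type*} {G : SimpleGraph V} {x y : V} :
    ∀ {a b : V} (p : G.Walk a b), p.edges.Nodup → s(x, y) ∈ p.edges →
      (∃ q : G.Walk a x, s(x, y) ∉ q.edges ∧ ∃ r : G.Walk y b, s(x, y) ∉ r.edges) ∨
        (∃ q : G.Walk a y, s(x, y) ∉ q.edges ∧ ∃ r : G.Walk x b, s(x, y) ∉ r.edges) := by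
  intro a b p
  induction p with
  | nil => intro _ h; simp at h
  | cons hadj p' ih =>
    rename_i a a' b'
    intro hnd hmem
    rw [SimpleGraph.Walk.edges_cons, List.nodup_cons] at hnd
    rw [SimpleGraph.Walk.edges_cons, List.mem_cons] at hmem
    rcases hmem with h | h
    · -- the first edge is `s(x,y)`
      have hne : s(x, y) ∉ p'.edges := h ▸ hnd.1
      rcases Sym2.eq_iff.1 h with ⟨rfl, rfl⟩ | ⟨rfl, rfl⟩
      · exact Or.inl ⟨SimpleGraph.Walk.nil, by simp, p', hne⟩
      · exact Or.inr ⟨SimpleGraph.Walk.nil, by simp, p', hne⟩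
    · have hne : s(x, y) ≠ s(a, a') := fun h' => hnd.1 (h' ▸ h)
      rcases ih hnd.2 h with ⟨q, hq, r, hr⟩ | ⟨q, hq, r, hr⟩
      · refine Or.inl ⟨SimpleGraph.Walk.cons hadj q, ?_, r, hr⟩
        rw [SimpleGraph.Walk.edges_cons, List.mem_cons]; push Not; exact ⟨hne, hq⟩
      · refine Or.inr ⟨SimpleGraph.Walk.cons hadj q, ?_, r, hr⟩
        rw [SimpleGraph.Walk.edges_cons, List.mem_cons]; push Not; exact ⟨hne, hq⟩

/-- **A pair on the cycle of a unicyclic graph is not needed for acyclicity**: if `G − z₀` is acyclic, `s(u,v)` is an edge of `G` and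
`u, v` are still joined in `G − s(u,v)`, then `G − s(u,v)` is acyclic. [folklore] -/
theorem isAcyclic_deleteEdges_of_cyclePair {V : Type*} (G : SimpleGraph V) (z₀ : Sym2 V) {u v : V}
    (hF : (G.deleteEdges {z₀}).IsAcyclic) (hadj : G.Adj u v) (hreach : (G.deleteEdges {s(u, v)}).Reachable u v) :
    (G.deleteEdges {s(u, v)}).IsAcyclic := by
  classical
  induction z₀ using Sym2.ind with
  | h x y =>
  by_cases hz : s(x, y) = s(u, v)
  · rw [← hz]; exact hF
  set G' := G.deleteEdges {s(u, v)} with hG'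
  -- `s(u,v)` is a bridge of `F = G − z₀`, i.e. `u, v` are not joined in `G' − z₀`
  have hbr : ¬ (G'.deleteEdges {s(x, y)}).Reachable u v := by
    have hadjF : (G.deleteEdges {s(x, y)}).Adj u v := by
      rw [SimpleGraph.deleteEdges_adj]; exact ⟨hadj, fun h => hz (Set.mem_singleton_iff.1 h).symm⟩
    have h := SimpleGraph.isBridge_iff.1 (SimpleGraph.isAcyclic_iff_forall_adj_isBridge.1 hF hadjF)
    rwa [SimpleGraph.deleteEdges_deleteEdges, Set.union_comm, ← SimpleGraph.deleteEdges_deleteEdges] at h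
  -- main: `x, y` are not joined in `G' − z₀` either (split the `u–v` path of `G'` at `z₀`)
  have main : ¬ (G'.deleteEdges {s(x, y)}).Reachable x y := by
    intro hR
    obtain ⟨p⟩ := hreach
    have hp : (p.bypass : G'.Walk u v).edges.Nodup := p.bypass_isPath.isTrail.edges_nodup
    by_cases hmem : s(x, y) ∈ p.bypass.edges
    · rcases walk_split_at_edge p.bypass hp hmem with ⟨q, hq, r, hr⟩ | ⟨q, hq, r, hr⟩
      · exact hbr (((SimpleGraph.reachable_deleteEdges_iff_exists_walk.2 ⟨q, hq⟩).trans hR).trans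
          (SimpleGraph.reachable_deleteEdges_iff_exists_walk.2 ⟨r, hr⟩))
      · exact hbr (((SimpleGraph.reachable_deleteEdges_iff_exists_walk.2 ⟨q, hq⟩).trans hR.symm).trans
          (SimpleGraph.reachable_deleteEdges_iff_exists_walk.2 ⟨r, hr⟩))
    · exact hbr (SimpleGraph.reachable_deleteEdges_iff_exists_walk.2 ⟨p.bypass, hmem⟩)
  -- every edge of `G'` is a bridge of `G'`
  rw [SimpleGraph.isAcyclic_iff_forall_adj_isBridge]
  intro a b hab
  rw [SimpleGraph.isBridge_iff]
  intro hR
  obtain ⟨q, hqf⟩ := SimpleGraph.reachable_deleteEdges_iff_exists_walk.1 hR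
  have hq'f : s(a, b) ∉ q.bypass.edges := fun h => hqf (q.edges_bypass_subset_edges h)
  have hnd : q.bypass.edges.Nodup := q.bypass_isPath.isTrail.edges_nodup
  by_cases hfz : s(x, y) = s(a, b)
  · rcases Sym2.eq_iff.1 hfz with ⟨rfl, rfl⟩ | ⟨rfl, rfl⟩
    · exact main (SimpleGraph.reachable_deleteEdges_iff_exists_walk.2 ⟨q.bypass, hq'f⟩)
    · have h := SimpleGraph.reachable_deleteEdges_iff_exists_walk.2 ⟨q.bypass, hq'f⟩
      rw [Sym2.eq_swap] at h
      exact main h.symm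
  -- `f = s(a,b) ≠ z₀`: `f` is a bridge of `F`
  have habG : G.Adj a b := (SimpleGraph.deleteEdges_adj.1 hab).1
  have hbrf : ¬ ((G.deleteEdges {s(x, y)}).deleteEdges {s(a, b)}).Reachable a b := by
    have hadjF : (G.deleteEdges {s(x, y)}).Adj a b := by
      rw [SimpleGraph.deleteEdges_adj]; exact ⟨habG, fun h => hfz (Set.mem_singleton_iff.1 h).symm⟩
    exact SimpleGraph.isBridge_iff.1 (SimpleGraph.isAcyclic_iff_forall_adj_isBridge.1 hF hadjF)
  by_cases hmem : s(x, y) ∈ q.bypass.edges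
  · -- `q'` passes through `z₀`: then `x, y` are joined in `G' − z₀` through `f`
    refine main ?_
    have hfD : (G'.deleteEdges {s(x, y)}).Adj a b := by
      rw [SimpleGraph.deleteEdges_adj]; exact ⟨hab, fun h => hfz (Set.mem_singleton_iff.1 h).symm⟩
    rcases walk_split_at_edge q.bypass hnd hmem with ⟨q₁, hq₁, r₁, hr₁⟩ | ⟨q₁, hq₁, r₁, hr₁⟩
    · have h1 : (G'.deleteEdges {s(x, y)}).Reachable a x := SimpleGraph.reachable_deleteEdges_iff_exists_walk.2 ⟨q₁, hq₁⟩
      have h2 : (G'.deleteEdges {s(x, y)}).Reachable y b := SimpleGraph.reachable_deleteEdges_iff_exists_walk.2 ⟨r₁, hr₁⟩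
      exact h1.symm.trans (hfD.reachable.trans h2.symm)
    · have h1 : (G'.deleteEdges {s(x, y)}).Reachable a y := SimpleGraph.reachable_deleteEdges_iff_exists_walk.2 ⟨q₁, hq₁⟩
      have h2 : (G'.deleteEdges {s(x, y)}).Reachable x b := SimpleGraph.reachable_deleteEdges_iff_exists_walk.2 ⟨r₁, hr₁⟩
      exact h2.trans (hfD.reachable.symm.trans h1)
  · -- `q'` avoids `z₀` (and `s(u,v)`, `f`): it lives in `F − f`
    apply hbrf
    refine ⟨q.bypass.transfer _ fun d hd => ?_⟩
    have hdG' := q.bypass.edges_subset_edgeSet hd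
    rw [hG', SimpleGraph.edgeSet_deleteEdges, Set.mem_sdiff] at hdG'
    rw [SimpleGraph.edgeSet_deleteEdges, SimpleGraph.edgeSet_deleteEdges, Set.mem_sdiff, Set.mem_sdiff]
    refine ⟨⟨hdG'.1, fun h => hmem ?_⟩, fun h => hq'f ?_⟩
    · rw [Set.mem_singleton_iff] at h; exact h ▸ hd
    · rw [Set.mem_singleton_iff] at h; exact h ▸ hd

variable {n : ℕ}

/-- **THE INCREASING STAR ON 'APEX + AT MOST ONE CYCLE'.**  If the environment of `w` is a forest after deleting one pair `z₀`, then
`0 ≤ E₃({s↔a},{s↔b},{s↔c})` under `prodBernoulli w`. [this work] -/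
theorem incStar_nonneg_of_apexUnicyclic (w : Sym2 (Fin n) → unitInterval) (s a b c : Fin n) (z₀ : Sym2 (Fin n))
    (hforest : ((SimpleGraph.fromEdgeSet {z : Sym2 (Fin n) | s ∉ z ∧ w z ≠ 0}).deleteEdges {z₀}).IsAcyclic) :
    0 ≤ sahiE3 (prodBernoulli w) (openConn s a) (openConn s b) (openConn s c) := by
  refine incStar_nonneg_of_apexUnicyclic_of_cycleChord ?_ w s a b c z₀ hforest
  intro w' z₁ s' u v a' b' c' hfor hus hvs huv hw0 hreach
  have he : ¬ (s(u, v) : Sym2 (Fin n)).IsDiag := by rwa [Sym2.mk_isDiag_iff]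
  have hadj : (SimpleGraph.fromEdgeSet {z : Sym2 (Fin n) | s' ∉ z ∧ w' z ≠ 0}).Adj u v := by
    rw [SimpleGraph.fromEdgeSet_adj]
    refine ⟨⟨?_, hw0⟩, huv⟩
    rw [Sym2.mem_iff]; push Not; exact ⟨fun h => hus h.symm, fun h => hvs h.symm⟩
  have hac := isAcyclic_deleteEdges_of_cyclePair _ z₁ hfor hadj hreach
  have hle : SimpleGraph.fromEdgeSet {z : Sym2 (Fin n) | s' ∉ z ∧ Function.update w' s(u, v) 0 z ≠ 0}
      ≤ (SimpleGraph.fromEdgeSet {z : Sym2 (Fin n) | s' ∉ z ∧ w' z ≠ 0}).deleteEdges {s(u, v)} := by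
    intro p q hpq
    rw [SimpleGraph.fromEdgeSet_adj] at hpq
    obtain ⟨⟨hs, hw⟩, hne⟩ := hpq
    rw [SimpleGraph.deleteEdges_adj, SimpleGraph.fromEdgeSet_adj]
    by_cases h : s(p, q) = s(u, v)
    · rw [h, Function.update_self] at hw; exact absurd rfl hw
    · rw [Function.update_of_ne h] at hw
      exact ⟨⟨⟨hs, hw⟩, hne⟩, fun h' => h (Set.mem_singleton_iff.1 h')⟩
  exact incStar_pair_chord_of_acyclic w' s' a' b' c' s(u, v) he (hac.anti hle)

/-- **One-pair Bernstein positivity** along every non-diagonal pair `e` whose deletion leaves an acyclic environment: all four Bernstein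
coefficients of the cubic `q ↦ E₃^{w[e↦q]}({s↔a},{s↔b},{s↔c})` are nonnegative (the extreme ones are the increasing star for `w[e↦0]`
(apex-forest) and `w[e↦1]` (apex + at most one cycle); the mixed ones follow from pair concavity at `(0,⅓,⅔)` and `(⅓,⅔,1)`).  This is the
one-pair Bernstein hypothesis of the edge-induction schemas of `…IncStarRootEdgeInduction` / `…IncStarStrongInduction`, proved on this class.
[this work] -/
theorem incStar_bernstein_nonneg_of_acyclic (w : Sym2 (Fin n) → unitInterval) (s a b c : Fin n) (e : Sym2 (Fin n))
    (he : ¬ e.IsDiag) (hforest : (SimpleGraph.fromEdgeSet {z : Sym2 (Fin n) | s ∉ z ∧ Function.update w e 0 z ≠ 0}).IsAcyclic) :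
    0 ≤ polar₁ (prodBernoulli (Function.update w e 0)) (prodBernoulli (Function.update w e 1)) (openConn s a) (openConn s b) (openConn s c)
      ∧ 0 ≤ polar₁ (prodBernoulli (Function.update w e 1)) (prodBernoulli (Function.update w e 0)) (openConn s a) (openConn s b) (openConn s c)
      ∧ 0 ≤ sahiE3 (prodBernoulli (Function.update w e 0)) (openConn s a) (openConn s b) (openConn s c)
      ∧ 0 ≤ sahiE3 (prodBernoulli (Function.update w e 1)) (openConn s a) (openConn s b) (openConn s c) := by
  -- the extreme coefficients: the increasing star for the pinned weights (environment minus `e` acyclic in both cases)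
  have hle : ∀ t : unitInterval, (SimpleGraph.fromEdgeSet {z : Sym2 (Fin n) | s ∉ z ∧ Function.update w e t z ≠ 0}).deleteEdges {e}
      ≤ SimpleGraph.fromEdgeSet {z : Sym2 (Fin n) | s ∉ z ∧ Function.update w e 0 z ≠ 0} := by
    intro t x y hxy
    rw [SimpleGraph.deleteEdges_adj, SimpleGraph.fromEdgeSet_adj] at hxy
    obtain ⟨⟨⟨hs, hw⟩, hne⟩, hz⟩ := hxy
    rw [SimpleGraph.fromEdgeSet_adj]
    have h : s(x, y) ≠ e := fun h' => hz (Set.mem_singleton_iff.2 h')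
    rw [Function.update_of_ne h] at hw
    refine ⟨⟨hs, ?_⟩, hne⟩
    rw [Function.update_of_ne h]; exact hw
  have B0 := incStar_nonneg_of_apexUnicyclic (Function.update w e 0) s a b c e (hforest.anti (hle 0))
  have B3 := incStar_nonneg_of_apexUnicyclic (Function.update w e 1) s a b c e (hforest.anti (hle 1))
  -- the Bernstein expansion of `E₃(w[e↦q])`
  have exp : ∀ q : unitInterval, sahiE3 (prodBernoulli (Function.update w e q)) (openConn s a) (openConn s b) (openConn s c)
      = (1 - (q : ℝ)) ^ 3 * sahiE3 (prodBernoulli (Function.update w e 0)) (openConn s a) (openConn s b) (openConn s c)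
        + 3 * (q : ℝ) * (1 - (q : ℝ)) ^ 2
          * polar₁ (prodBernoulli (Function.update w e 0)) (prodBernoulli (Function.update w e 1)) (openConn s a) (openConn s b) (openConn s c)
        + 3 * (q : ℝ) ^ 2 * (1 - (q : ℝ))
          * polar₁ (prodBernoulli (Function.update w e 1)) (prodBernoulli (Function.update w e 0)) (openConn s a) (openConn s b) (openConn s c)
        + (q : ℝ) ^ 3 * sahiE3 (prodBernoulli (Function.update w e 1)) (openConn s a) (openConn s b) (openConn s c) := by
    intro q
    have h := sahiE3_oneBond (Function.update w e q) e (openConn s a) (openConn s b) (openConn s c)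
    rwa [Function.update_idem, Function.update_idem, Function.update_self] at h
  -- pair concavity at `(0, 1/3, 2/3)` and `(1/3, 2/3, 1)`
  have m13 : (1 / 3 : ℝ) ∈ unitInterval := Set.mem_Icc.2 ⟨by norm_num, by norm_num⟩
  have m23 : (2 / 3 : ℝ) ∈ unitInterval := Set.mem_Icc.2 ⟨by norm_num, by norm_num⟩
  have o1 : (0 : unitInterval) ≤ ⟨1 / 3, m13⟩ := by
    have h : ((0 : unitInterval) : ℝ) ≤ ((⟨1 / 3, m13⟩ : unitInterval) : ℝ) := by norm_num
    exact_mod_cast h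
  have o2 : (⟨1 / 3, m13⟩ : unitInterval) ≤ ⟨2 / 3, m23⟩ := by
    have h : ((⟨1 / 3, m13⟩ : unitInterval) : ℝ) ≤ ((⟨2 / 3, m23⟩ : unitInterval) : ℝ) := by norm_num
    exact_mod_cast h
  have o3 : (⟨2 / 3, m23⟩ : unitInterval) ≤ 1 := by
    have h : ((⟨2 / 3, m23⟩ : unitInterval) : ℝ) ≤ ((1 : unitInterval) : ℝ) := by norm_num
    exact_mod_cast h
  have h1 := incStar_pair_threePoint_of_acyclic w s a b c e he hforest 0 ⟨1 / 3, m13⟩ ⟨2 / 3, m23⟩ o1 o2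
  have h2 := incStar_pair_threePoint_of_acyclic w s a b c e he hforest ⟨1 / 3, m13⟩ ⟨2 / 3, m23⟩ 1 o2 o3
  rw [exp ⟨1 / 3, m13⟩, exp ⟨2 / 3, m23⟩] at h1 h2
  norm_num at h1 h2
  refine ⟨by linarith, by linarith, B0, B3⟩

end IncStar

end Summit.CriticalPhenomena.PercolationContinuityZ3.Theorems
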